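import Summits.Ventures.PercRepro.Night2ShadowForm
import Summits.Ventures.PercRepro.GenQBalance

/-!
# PercRepro — the LOCAL form of the diagonal shadow condition (night-2, gen 6)

`Night2ShadowForm.lean` records the shadow form of C-025: Hall's condition on containment between the bottom
sets `Uq M p q` and the middle level.  At the diagonal `(q + 2, q)` the middle level consists of the sets of
rank `q + 1`, and every such set `S` has a rank-`(q + 1)` flat as closure.  This file LOCALISES the diagonal
shadow condition to one rank-`(q + 1)` flat `G` at a time:

* `shadowAt M p q 𝒜 G` = the shadow sets whose closure is `G`; `membersIn M 𝒜 G` = the members of `𝒜` whose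
  closure lies in `G`; `localWeight M B G = |G ∖ cl B| / |E ∖ cl B|`;
* **`LocalShadowHall M q G`** = «for every `𝒜 ⊆ Uq M (q+2) q`:
  `(q+2)/(q+1) · Σ_{B ∈ membersIn 𝒜 G} localWeight B G ≤ #shadowAt 𝒜 G`» — the local inequality (LI_G);
* **`LocalShadowC025`** — the statement of record (a conjecture): (LI_G) at every rank-`(q+1)` flat of every
  finite matroid.  Census (own code `mining/night-2/g6/`): every matroid on ≤ 8 elements, every diagonal, every
  `G`, families `U` / per-flat / all sub-families when `#U ≤ 12` else random — 206,846 (n ≤ 6) + 732,954 (n = 7)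
  + 11,519,993 (n = 8) local tests, 0 failures, the only tight instances are the Boolean-like flats; the q ≥ 10
  star ambients by orbit max-flow: (LI_G) holds at every `G`-type with margin ≥ 1.12;
* **`shadowHall_of_local`** (THEOREM): the local condition at every rank-`(q+1)` flat implies the diagonal shadow
  condition `ShadowHall M (q+2) q ((q+2)/(q+1))` — the shadow is partitioned by the closures of its sets, and
  for a bottom set `B` the sets `G ∖ cl B` over the rank-`(q+1)` flats `G ⊇ cl B` partition `E ∖ cl B` (each
  `z ∉ cl B` lies in exactly one of them, `cl (cl B ∪ {z})`), so the local weights of `B` sum to `1`;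
  `c025_diag_of_local`: hence the body of C-025 at the diagonal.
-/

namespace PercRepro.Shadow

open Finset PerFlat ThmH

variable {α : Type*} [DecidableEq α] {M : Matroid α} [M.Finite]

/-! ## The local objects -/

open scoped Classical in
/-- The part of the shadow of `𝒜` whose closure is the flat `G`. -/
noncomputable def shadowAt (M : Matroid α) [M.Finite] (p q : ℕ) (𝒜 : Finset (Finset α)) (G : Finset α) :
    Finset (Finset α) :=
  (shadow M p q 𝒜).filter (fun S => clF M S = G)

open scoped Classical in
/-- The members of `𝒜` whose closure lies in `G`. -/
noncomputable def membersIn (M : Matroid α) [M.Finite] (𝒜 : Finset (Finset α)) (G : Finset α) :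
    Finset (Finset α) :=
  𝒜.filter (fun B => clF M B ⊆ G)

/-- The local weight of a bottom set `B` at the flat `G`: `|G ∖ cl B| / |E ∖ cl B|`. -/
noncomputable def localWeight (M : Matroid α) [M.Finite] (B G : Finset α) : ℚ :=
  ((G \ clF M B).card : ℚ) / ((gr M \ clF M B).card : ℚ)

/-- **The local shadow condition at `G`** (LI_G): for every sub-family `𝒜` of the bottom sets, the shadow sets
with closure `G` number at least `(q+2)/(q+1)` times the total local weight of the members of `𝒜` inside `G`. -/
def LocalShadowHall (M : Matroid α) [M.Finite] (q : ℕ) (G : Finset α) : Prop :=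
  ∀ 𝒜 ⊆ Uq M (q + 2) q,
    (((q : ℚ) + 2) / ((q : ℚ) + 1)) * ∑ B ∈ membersIn M 𝒜 G, localWeight M B G ≤
      ((shadowAt M (q + 2) q 𝒜 G).card : ℚ)

/-- **THE LOCAL FORM OF THE DIAGONAL SHADOW CONDITION** (statement of record of the night-2 lane, gen 6; a
conjecture): (LI_G) at every rank-`(q + 1)` flat `G` of every finite matroid. -/
def LocalShadowC025 : Prop :=
  ∀ {α : Type} [DecidableEq α] (M : Matroid α) [M.Finite] (q : ℕ) (G : Finset α),
    G ∈ flatsQ M (q + 1) → LocalShadowHall M q G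

/-! ## Membership lemmas -/

open scoped Classical in
/-- Membership in `shadowAt`. -/
theorem mem_shadowAt {p q : ℕ} {𝒜 : Finset (Finset α)} {G S : Finset α} :
    S ∈ shadowAt M p q 𝒜 G ↔ S ∈ shadow M p q 𝒜 ∧ clF M S = G := by
  unfold shadowAt
  rw [Finset.mem_filter]

open scoped Classical in
/-- Membership in `membersIn`. -/
theorem mem_membersIn {𝒜 : Finset (Finset α)} {G B : Finset α} :
    B ∈ membersIn M 𝒜 G ↔ B ∈ 𝒜 ∧ clF M B ⊆ G := by
  unfold membersIn
  rw [Finset.mem_filter]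

omit [DecidableEq α] in
/-- A middle-level set at the diagonal has rank exactly `q + 1`. -/
theorem eRk_eq_of_mem_Yq_diag {q : ℕ} {S : Finset α} (hS : S ∈ Yq M (q + 2) q) :
    M.eRk (S : Set α) = ((q + 1 : ℕ) : ℕ∞) := by
  unfold Yq at hS
  rw [Finset.mem_filter, Finset.mem_powerset] at hS
  obtain ⟨-, h1, h2⟩ := hS
  have hne : M.eRk (S : Set α) ≠ ⊤ := ne_top_of_lt h2
  obtain ⟨n, hn⟩ := ENat.ne_top_iff_exists.1 hne
  rw [← hn] at h1 h2 ⊢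
  have h1' : q < n := by exact_mod_cast h1
  have h2' : n < q + 2 := by exact_mod_cast h2
  congr 1
  omega

omit [DecidableEq α] in
/-- A subset of the ground set lies in its closure. -/
theorem subset_clF_of_subset_gr {S : Finset α} (hS : S ⊆ gr M) : S ⊆ clF M S := by
  rw [← Finset.coe_subset, coe_clF]
  exact M.subset_closure _ (by rw [← coe_gr]; exact_mod_cast hS)

omit [DecidableEq α] in
/-- The closure of a middle-level set at the diagonal is a rank-`(q + 1)` flat. -/
theorem clF_mem_flatsQ_of_mem_Yq_diag {q : ℕ} {S : Finset α} (hS : S ∈ Yq M (q + 2) q) :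
    clF M S ∈ flatsQ M (q + 1) := by
  have hr := eRk_eq_of_mem_Yq_diag hS
  rw [mem_flatsQ, ← Finset.coe_subset, coe_clF, coe_gr]
  exact ⟨M.closure_subset_ground _, M.isFlat_closure _, by rw [M.eRk_closure_eq, hr]⟩

/-! ## The shadow is partitioned by closures -/

open scoped Classical in
/-- `#shadow = Σ_G #shadowAt G` over the rank-`(q + 1)` flats. -/
theorem card_shadow_eq_sum_shadowAt {q : ℕ} (𝒜 : Finset (Finset α)) :
    (shadow M (q + 2) q 𝒜).card = ∑ G ∈ flatsQ M (q + 1), (shadowAt M (q + 2) q 𝒜 G).card := by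
  rw [Finset.card_eq_sum_card_fiberwise (f := fun S => clF M S) (t := flatsQ M (q + 1))]
  · rfl
  · intro S hS
    exact clF_mem_flatsQ_of_mem_Yq_diag (shadow_subset_Yq 𝒜 hS)

/-! ## The local weights of a bottom set sum to one -/

/-- A flat of rank `q + 1` inside a rank-`(q + 1)` flat `G` equals `G`. -/
theorem flat_eq_of_subset_of_eRk_eq {q : ℕ} {X G : Finset α} (hG : G ∈ flatsQ M (q + 1))
    (hX : M.IsFlat (X : Set α)) (hXG : X ⊆ G) (hr : M.eRk (X : Set α) = ((q + 1 : ℕ) : ℕ∞)) : X = G := by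
  rw [mem_flatsQ] at hG
  obtain ⟨hGg, -, hGr⟩ := hG
  by_contra hne
  obtain ⟨g, hgG, hgX⟩ := Finset.exists_of_ssubset (lt_of_le_of_ne hXG hne)
  have hgE : g ∈ M.E \ M.closure (X : Set α) := by
    refine ⟨by rw [← coe_gr]; exact_mod_cast hGg hgG, ?_⟩
    rw [hX.closure]
    exact_mod_cast hgX
  have h1 : M.eRk ((insert g X : Finset α) : Set α) = ((q + 2 : ℕ) : ℕ∞) := by
    rw [Finset.coe_insert, Matroid.eRk_insert_eq_add_one hgE, hr]
    push_cast
    rfl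
  have h2 : M.eRk ((insert g X : Finset α) : Set α) ≤ ((q + 1 : ℕ) : ℕ∞) := by
    rw [← hGr]
    exact M.eRk_mono (by exact_mod_cast Finset.insert_subset hgG hXG)
  rw [h1] at h2
  have : q + 2 ≤ q + 1 := by exact_mod_cast h2
  omega

/-- For a rank-`q` flat `F` and `z ∈ E ∖ F`, the closure of `F ∪ {z}` is a rank-`(q + 1)` flat containing `F`. -/
theorem clF_insert_mem_flatsQ {q : ℕ} {F : Finset α} (hF : F ∈ flatsQ M q) {z : α} (hz : z ∈ gr M \ F) :
    clF M (insert z F) ∈ flatsQ M (q + 1) ∧ F ⊆ clF M (insert z F) := by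
  rw [mem_flatsQ] at hF
  obtain ⟨hFg, hFflat, hFr⟩ := hF
  rw [Finset.mem_sdiff] at hz
  have hzE : z ∈ M.E \ M.closure (F : Set α) := by
    refine ⟨by rw [← coe_gr]; exact_mod_cast hz.1, ?_⟩
    rw [hFflat.closure]
    exact_mod_cast hz.2
  refine ⟨?_, ?_⟩
  · rw [mem_flatsQ, ← Finset.coe_subset, coe_clF, coe_gr]
    refine ⟨M.closure_subset_ground _, M.isFlat_closure _, ?_⟩
    rw [M.eRk_closure_eq, Finset.coe_insert, Matroid.eRk_insert_eq_add_one hzE, hFr]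
    push_cast
    rfl
  · rw [← Finset.coe_subset, coe_clF]
    exact (M.subset_closure _ (by
      rw [Finset.coe_insert]
      exact Set.insert_subset hzE.1 (by rw [← coe_gr]; exact_mod_cast hFg))).trans'
      (by rw [Finset.coe_insert]; exact Set.subset_insert _ _)

/-- For a rank-`(q + 1)` flat `G ⊇ F` and `z ∈ E ∖ F`: `cl (F ∪ {z}) = G` iff `z ∈ G`. -/
theorem clF_insert_eq_iff {q : ℕ} {F : Finset α} (hF : F ∈ flatsQ M q) {G : Finset α}
    (hG : G ∈ flatsQ M (q + 1)) (hFG : F ⊆ G) {z : α} (hz : z ∈ gr M \ F) :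
    clF M (insert z F) = G ↔ z ∈ G := by
  obtain ⟨hcl, -⟩ := clF_insert_mem_flatsQ hF hz
  constructor
  · intro h
    rw [← h]
    exact subset_clF_of_subset_gr (Finset.insert_subset (Finset.mem_sdiff.1 hz).1 (mem_flatsQ.1 hF).1)
      (Finset.mem_insert_self _ _)
  · intro hzG
    have hGflat := (mem_flatsQ.1 hG).2.1
    have hsub : clF M (insert z F) ⊆ G := by
      rw [← Finset.coe_subset, coe_clF]
      have : ((insert z F : Finset α) : Set α) ⊆ (G : Set α) := by
        rw [Finset.coe_insert]
        exact Set.insert_subset (by exact_mod_cast hzG) (by exact_mod_cast hFG)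
      exact (M.closure_subset_closure this).trans hGflat.closure.subset
    exact flat_eq_of_subset_of_eRk_eq hG (by rw [coe_clF]; exact M.isFlat_closure _) hsub
      (mem_flatsQ.1 hcl).2.2

open scoped Classical in
/-- **The partition of `E ∖ F` by the rank-`(q + 1)` flats above the rank-`q` flat `F`**:
`Σ_{G ⊇ F} |G ∖ F| = |E ∖ F|`. -/
theorem sum_card_sdiff_eq {q : ℕ} {F : Finset α} (hF : F ∈ flatsQ M q) :
    ∑ G ∈ (flatsQ M (q + 1)).filter (fun G => F ⊆ G), (G \ F).card = (gr M \ F).card := by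
  symm
  rw [Finset.card_eq_sum_card_fiberwise (f := fun z => clF M (insert z F))
    (t := (flatsQ M (q + 1)).filter (fun G => F ⊆ G))]
  · apply Finset.sum_congr rfl
    intro G hG
    rw [Finset.mem_filter] at hG
    congr 1
    ext z
    rw [Finset.mem_filter, Finset.mem_sdiff, Finset.mem_sdiff]
    constructor
    · rintro ⟨⟨hzg, hzF⟩, hcl⟩
      exact ⟨(clF_insert_eq_iff hF hG.1 hG.2 (Finset.mem_sdiff.2 ⟨hzg, hzF⟩)).1 hcl, hzF⟩
    · rintro ⟨hzG, hzF⟩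
      have hzg : z ∈ gr M := (mem_flatsQ.1 hG.1).1 hzG
      exact ⟨⟨hzg, hzF⟩, (clF_insert_eq_iff hF hG.1 hG.2 (Finset.mem_sdiff.2 ⟨hzg, hzF⟩)).2 hzG⟩
  · intro z hz
    rw [Finset.mem_coe] at hz ⊢
    rw [Finset.mem_filter]
    exact clF_insert_mem_flatsQ hF hz

open scoped Classical in
/-- The local weights of a bottom set over the rank-`(q + 1)` flats containing its closure sum to `1`. -/
theorem sum_localWeight_eq_one {q : ℕ} {B : Finset α} (hB : B ∈ Uq M (q + 2) q) :
    ∑ G ∈ (flatsQ M (q + 1)).filter (fun G => clF M B ⊆ G), localWeight M B G = 1 := by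
  have hF : clF M B ∈ flatsQ M q := clF_mem_flatsQ hB
  have hpos : (0 : ℚ) < ((gr M \ clF M B).card : ℚ) := by
    have := two_le_card_compl_clF hB
    exact_mod_cast (by omega : 0 < (gr M \ clF M B).card)
  unfold localWeight
  rw [← Finset.sum_div, div_eq_one_iff_eq hpos.ne']
  exact_mod_cast sum_card_sdiff_eq hF

/-! ## The local condition at every flat gives the diagonal shadow condition -/

open scoped Classical in
/-- Exchanging the double sum: `Σ_{B ∈ 𝒜} Σ_{G ⊇ cl B} w(B, G) = Σ_G Σ_{B ∈ membersIn 𝒜 G} w(B, G)`. -/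
theorem sum_sum_localWeight_comm {q : ℕ} (𝒜 : Finset (Finset α)) :
    ∑ B ∈ 𝒜, ∑ G ∈ (flatsQ M (q + 1)).filter (fun G => clF M B ⊆ G), localWeight M B G =
      ∑ G ∈ flatsQ M (q + 1), ∑ B ∈ membersIn M 𝒜 G, localWeight M B G := by
  unfold membersIn
  simp only [Finset.sum_filter]
  exact Finset.sum_comm

/-- **THEOREM.** The local condition at every rank-`(q + 1)` flat gives the diagonal shadow condition with the
constant `(q + 2)/(q + 1)`. -/
theorem shadowHall_of_local {q : ℕ} (h : ∀ G ∈ flatsQ M (q + 1), LocalShadowHall M q G) :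
    ShadowHall M (q + 2) q (((q : ℚ) + 2) / ((q : ℚ) + 1)) := by
  classical
  intro 𝒜 h𝒜
  have hsum : (𝒜.card : ℚ) = ∑ G ∈ flatsQ M (q + 1), ∑ B ∈ membersIn M 𝒜 G, localWeight M B G := by
    rw [← sum_sum_localWeight_comm]
    rw [Finset.card_eq_sum_ones, Nat.cast_sum]
    apply Finset.sum_congr rfl
    intro B hB
    rw [sum_localWeight_eq_one (h𝒜 hB)]
    simp
  rw [hsum, Finset.mul_sum, card_shadow_eq_sum_shadowAt, Nat.cast_sum]
  apply Finset.sum_le_sum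
  intro G hG
  exact h G hG 𝒜 h𝒜

/-- The local condition at every flat of every matroid gives the shadow form of C-025 at every diagonal, with the
constant `phiK (q + 2) q`. -/
theorem shadowHall_diag_of_localC025 (hloc : LocalShadowC025) {α : Type} [DecidableEq α] (M : Matroid α) [M.Finite]
    (q : ℕ) : ShadowHall M (q + 2) q (phiK (q + 2) q) := by
  rw [GenQ.phiK_succ_succ]
  exact shadowHall_of_local (fun G hG => hloc M q G hG)

/-- **The body of C-025 at the diagonal `(q + 2, q)` follows from the local form.** -/
theorem c025_diag_of_localC025 (hloc : LocalShadowC025) {α : Type} [DecidableEq α] (M : Matroid α) [M.Finite]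
    (q : ℕ) :
    phiK (q + 2) q * ({A : Set α | A ⊆ M.E ∧ M.eRk A = ((q + 2 : ℕ) : ℕ∞) ∧ M.eRk (M.E \ A) = (q : ℕ∞)}.ncard : ℚ) ≤
      ({A : Set α | A ⊆ M.E ∧ (q : ℕ∞) < M.eRk A ∧ M.eRk A < ((q + 2 : ℕ) : ℕ∞)}.ncard : ℚ) :=
  c025_of_shadowHall (shadowHall_diag_of_localC025 hloc M q)

end PercRepro.Shadow
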